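import Summits.BirchSwinnertonDyer.BirchSwinnertonDyer.Theses.KatoDescentPotSupersingular
import HarnessLib

/-!
# Route `KatoDescentPotSupersingular` (rung K9, wild `3`, cell `bsd-potss`): glue item 21424
# `WildJetchevBoundAtPOfTwoSplitCases` — crux 19941 `WildJetchevBoundAtP` from its two split children
# `WildJetchevBoundAtPTwoSplit` (21422, «2 splits in K») and `WildJetchevBoundAtPTwoNonsplit` (21423, «2 does not split in K»)
# by a classical case split on `SatisfiesHeegnerHypothesis 2 K`

Cell `bsd-potss`, seat `bsd-potss-k9-c4` g11 (prover); `--workitem stmt-BirchSwinnertonDyer-21424`. Pure glue (plan g24's split of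
19941, INBOX 19:45Z / 20:28Z; the planner's sketch `k9split/Sketch.lean`): no mathematics beyond `by_cases`. HONEST FRAMING: this closes
the GLUE item only; the two children stay open (21422 is a kernel theorem modulo four named facts — this seat's
`JetchevIrreducibleSwapAtP.wildJetchevBoundAtPTwoSplit_of_namedFacts`; 21423 is the open slice); BSD is not proved for any curve.
[cite: Jetchev2008, Cor. 1.5 (p. 812)] [cite: BumpFriedbergHoffstein1990, Theorem (pp. 543–544)]
-/

set_option autoImplicit false
-- the Theorems directory repeats the summit name (sibling precedent `KatoDescentPotSupersingularAssembly.lean`)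
set_option linter.dupNamespace false

namespace Summit.BirchSwinnertonDyer.BirchSwinnertonDyer.Theorems

open Literature.NumberTheory.EllipticCurves

/-- **Glue 21424**: `WildJetchevBoundAtPTwoSplit → WildJetchevBoundAtPTwoNonsplit → WildJetchevBoundAtP` — introduce the binders of
`WildJetchevBoundAtP`, case on `SatisfiesHeegnerHypothesis 2 K`, apply the matching child. [cite: Jetchev2008, Cor. 1.5 (p. 812)] -/
theorem wildJetchevBoundAtPOfTwoSplitCases_proof :
    Theses.KatoDescentPotSupersingular.WildJetchevBoundAtPOfTwoSplitCases := by
  intro hS hN N _ W _ _ K _ _ hK hD3 hH p _ hp2 hr hadd hj hcm hirr hns hD P hP hnt hpN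
  by_cases h2 : SatisfiesHeegnerHypothesis 2 K
  · exact hS N W K hK hD3 hH h2 p hp2 hr hadd hj hcm hirr hns hD hP hnt hpN
  · exact hN N W K hK hD3 hH h2 p hp2 hr hadd hj hcm hirr hns hD hP hnt hpN

end Summit.BirchSwinnertonDyer.BirchSwinnertonDyer.Theorems
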